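import Summits.QuantumFields.GaugeBoot.FluctuationQuotient
import HarnessLib

/-!
# Fluctuations of Wilson loops, VIII: the loop equation for the coefficients (gauge-boot, ADDENDUM 32 part H)

HONEST FRAMING (cell `pub-gaugeboot`, page 1 of every file): the venture produces certified bounds
on lattice expectations at stated coupling, gauge group, dimension and torus size; NOT a mass gap,
NOT a continuum limit, NOT a string tension; NOT Yang–Mills-summit-bearing (barriers
`FixedCouplingUltralocality`, `PerturbativeInvisibility`).  Strong-coupling `SO(N)` lattice gauge theory with free boundary
condition (S. Chatterjee, Comm. Math. Phys. **366** (2019); S. Chatterjee, J. Jafarov, arXiv:1604.04777); nothing about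
four-dimensional continuum Yang–Mills or a mass gap.

## Content

★ `centered_equation_coeff`: the centered-block loop equation of part F, instantiated in `ℝ⟦X⟧ ⧸ (X^{K+1})` for the moment
functional `P(s) = Σ_k f_k(β,s)X^k` (part G) and read off COEFFICIENTWISE: with `g_k(σ) := coeff_k G(σ)` (the order-`k`
coefficient of the centered block product) and the REAL block operators `SD, TW, ME, XM` (at `b = β`), for every `k ≤ K`
and every genuine state `σ = (B₀; C₁,…,C_m)` with non-null blocks,

`|σ| g_k(σ) − SD_{B₀} g_k − Σ_j SD_{C_j} g_k = [k ≥ 1](|σ| g_{k−1}(σ) + TW_{B₀} g_{k−1} + Σ_j TW_{C_j} g_{k−1})`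
`   + [k ≥ 2]( ME_{B₀} g_{k−2} + Σ_j ME_{C_j} g_{k−2} + Σ_j XM(B₀,C_j)[g_{k−2}] + Σ_{j<j'} XM(C_j,C_{j'})[g_{k−2}(B₀; M, …) + Σ_{a+b=k−2} f_a(M) g_b(B₀; …)] )`.

Everything is `[new (lane)]` bookkeeping given parts F–G.
-/

noncomputable section

open Finset Filter Topology PowerSeries
open Literature.MathematicalPhysics.QuantumFieldTheory.Chatterjee2019LargeN

namespace Summit.QuantumFields.GaugeBoot

namespace StringDuality

variable {d : ℕ} {β : ℝ} {K : ℕ} {F : ℕ → ℝ → LoopSeq d → ℝ}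

/-- ★ **The loop equation for the coefficients of the centered block products.**  See the module docstring.
[cite: Chatterjee2019LargeN, Theorem 3.6; ChatterjeeJafarov2016OneOverN, Theorem 5.1] -/
theorem centered_equation_coeff
    (hF0 : ∀ u : LoopSeq d, F 0 β u = 0) (hF1 : ∀ u : LoopSeq d, F 1 β u = 0)
    (hrec : ∀ k, k ≤ K → ∀ s : LoopSeq d, IsLoopSeq s → s ≠ [] →
      (s.len : ℝ) * F (k + 2) β s -
          ((∑ o : InvIdx s, F (k + 2) β (s.negSplitAt o)) - (∑ o : SameIdx s, F (k + 2) β (s.posSplitAt o))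
            + β * (∑ o : DeformIdx s, F (k + 2) β (s.negDeformAt o))
            - β * (∑ o : DeformIdx s, F (k + 2) β (s.posDeformAt o))) =
        (s.len : ℝ) * F (k + 1) β s
          + ((∑ o : SameIdx s, F (k + 1) β (s.negTwistAt o)) - ∑ o : InvIdx s, F (k + 1) β (s.posTwistAt o))
          + ((∑ o : MergeIdx s, F k β (s.negMergeAt o)) - ∑ o : MergeIdx s, F k β (s.posMergeAt o)))
    (hperm : ∀ k, k ≤ K → ∀ s s' : LoopSeq d, IsLoopSeq s → s.Perm s' → F (k + 2) β s = F (k + 2) β s')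
    (P : LoopSeq d → PowerSeries ℝ) (hP : ∀ (u : LoopSeq d) (k : ℕ), coeff k (P u) = F (k + 2) β u)
    {G : LoopSeq d → List (LoopSeq d) → PowerSeries ℝ} (hG0 : ∀ B₀ : LoopSeq d, G B₀ [] = P B₀)
    (hGs : ∀ (B₀ C : LoopSeq d) (rest : List (LoopSeq d)), G B₀ (C :: rest) = G (B₀ ++ C) rest - P C * G B₀ rest)
    (SD TW ME : LoopSeq d → (LoopSeq d → ℝ) → ℝ) (XM : LoopSeq d → LoopSeq d → (LoopSeq d → ℝ) → ℝ)
    (hSD : ∀ (A : LoopSeq d) (g : LoopSeq d → ℝ), SD A g =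
      ((∑ o : InvIdx A, g (A.negSplitAt o)) - ∑ o : SameIdx A, g (A.posSplitAt o))
        + β * ((∑ o : DeformIdx A, g (A.negDeformAt o)) - ∑ o : DeformIdx A, g (A.posDeformAt o)))
    (hTW : ∀ (A : LoopSeq d) (g : LoopSeq d → ℝ), TW A g =
      (∑ o : SameIdx A, g (A.negTwistAt o)) - ∑ o : InvIdx A, g (A.posTwistAt o))
    (hME : ∀ (A : LoopSeq d) (g : LoopSeq d → ℝ), ME A g =
      (∑ o : MergeIdx A, g (A.negMergeAt o)) - ∑ o : MergeIdx A, g (A.posMergeAt o))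
    (hXM : ∀ (A B : LoopSeq d) (g : LoopSeq d → ℝ), XM A B g =
      (∑ i : Fin A.length, ∑ j : Fin B.length,
          ∑ q : {xy : Fin (A.get i).length × Fin (B.get j).length // ((B.get j).get xy.2).1 = ((A.get i).get xy.1).1},
            (g (A.take i ++ LoopSeq.prune [Word.negMerge _ q.1.1 _ q.1.2] ++ A.drop (i + 1) ++ B.eraseIdx j)
              - g (A.take i ++ LoopSeq.prune [Word.posMerge _ q.1.1 _ q.1.2] ++ A.drop (i + 1) ++ B.eraseIdx j)))
      + ∑ j : Fin B.length, ∑ i : Fin A.length,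
          ∑ q : {xy : Fin (B.get j).length × Fin (A.get i).length // ((A.get i).get xy.2).1 = ((B.get j).get xy.1).1},
            (g (A.eraseIdx i ++ (B.take j ++ LoopSeq.prune [Word.negMerge _ q.1.1 _ q.1.2] ++ B.drop (j + 1)))
              - g (A.eraseIdx i ++ (B.take j ++ LoopSeq.prune [Word.posMerge _ q.1.1 _ q.1.2] ++ B.drop (j + 1)))))
    (k : ℕ) (hk : k ≤ K) (Cs : List (LoopSeq d)) (hCs : ∀ C ∈ Cs, IsLoopSeq C ∧ C ≠ []) (B₀ : LoopSeq d)
    (hB₀ : IsLoopSeq B₀) :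
    ((B₀.len + (Cs.map LoopSeq.len).sum : ℕ) : ℝ) * coeff k (G B₀ Cs)
        - SD B₀ (fun A => coeff k (G A Cs)) - ∑ j : Fin Cs.length, SD (Cs.get j) (fun C' => coeff k (G B₀ (Cs.set j C'))) =
      (if k = 0 then 0 else
        (((B₀.len + (Cs.map LoopSeq.len).sum : ℕ) : ℝ) * coeff (k - 1) (G B₀ Cs) + TW B₀ (fun A => coeff (k - 1) (G A Cs))
          + ∑ j : Fin Cs.length, TW (Cs.get j) (fun C' => coeff (k - 1) (G B₀ (Cs.set j C')))))
      + (if k < 2 then 0 else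
        (ME B₀ (fun A => coeff (k - 2) (G A Cs))
          + (∑ j : Fin Cs.length, ME (Cs.get j) (fun C' => coeff (k - 2) (G B₀ (Cs.set j C'))))
          + (∑ j : Fin Cs.length, XM B₀ (Cs.get j) (fun M => coeff (k - 2) (G M (Cs.eraseIdx j))))
          + ∑ j : Fin Cs.length, ∑ j' : Fin Cs.length, if (j : ℕ) < j' then
              XM (Cs.get j) (Cs.get j') (fun M => coeff (k - 2) (G B₀ ((Cs.set j M).eraseIdx j'))
                + ∑ q ∈ antidiagonal (k - 2), F (q.1 + 2) β M * coeff q.2 (G B₀ ((Cs.eraseIdx j').eraseIdx j)))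
            else 0)) := by
  -- ### the quotient ring and its data
  set I : Ideal (PowerSeries ℝ) := Ideal.span {(X : PowerSeries ℝ) ^ (K + 1)} with hI
  set π : PowerSeries ℝ →+* PowerSeries ℝ ⧸ I := Ideal.Quotient.mk I with hπ
  -- operators at the `ℝ⟦X⟧` level (`b = C β`) and at the quotient level (`b = π (C β)`)
  obtain ⟨SDX, hSDX⟩ : ∃ SDX : LoopSeq d → (LoopSeq d → PowerSeries ℝ) → PowerSeries ℝ, ∀ A g, SDX A g =
      ((∑ o : InvIdx A, g (A.negSplitAt o)) - ∑ o : SameIdx A, g (A.posSplitAt o))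
        + C β * ((∑ o : DeformIdx A, g (A.negDeformAt o)) - ∑ o : DeformIdx A, g (A.posDeformAt o)) :=
    ⟨fun A g => _, fun _ _ => rfl⟩
  obtain ⟨TWX, hTWX⟩ : ∃ TWX : LoopSeq d → (LoopSeq d → PowerSeries ℝ) → PowerSeries ℝ, ∀ A g, TWX A g =
      (∑ o : SameIdx A, g (A.negTwistAt o)) - ∑ o : InvIdx A, g (A.posTwistAt o) := ⟨fun A g => _, fun _ _ => rfl⟩
  obtain ⟨MEX, hMEX⟩ : ∃ MEX : LoopSeq d → (LoopSeq d → PowerSeries ℝ) → PowerSeries ℝ, ∀ A g, MEX A g =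
      (∑ o : MergeIdx A, g (A.negMergeAt o)) - ∑ o : MergeIdx A, g (A.posMergeAt o) := ⟨fun A g => _, fun _ _ => rfl⟩
  obtain ⟨XMX, hXMX⟩ : ∃ XMX : LoopSeq d → LoopSeq d → (LoopSeq d → PowerSeries ℝ) → PowerSeries ℝ, ∀ A B g, XMX A B g =
      (∑ i : Fin A.length, ∑ j : Fin B.length,
          ∑ q : {xy : Fin (A.get i).length × Fin (B.get j).length // ((B.get j).get xy.2).1 = ((A.get i).get xy.1).1},
            (g (A.take i ++ LoopSeq.prune [Word.negMerge _ q.1.1 _ q.1.2] ++ A.drop (i + 1) ++ B.eraseIdx j)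
              - g (A.take i ++ LoopSeq.prune [Word.posMerge _ q.1.1 _ q.1.2] ++ A.drop (i + 1) ++ B.eraseIdx j)))
      + ∑ j : Fin B.length, ∑ i : Fin A.length,
          ∑ q : {xy : Fin (B.get j).length × Fin (A.get i).length // ((A.get i).get xy.2).1 = ((B.get j).get xy.1).1},
            (g (A.eraseIdx i ++ (B.take j ++ LoopSeq.prune [Word.negMerge _ q.1.1 _ q.1.2] ++ B.drop (j + 1)))
              - g (A.eraseIdx i ++ (B.take j ++ LoopSeq.prune [Word.posMerge _ q.1.1 _ q.1.2] ++ B.drop (j + 1)))) :=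
    ⟨fun A B g => _, fun _ _ _ => rfl⟩
  obtain ⟨SDQ, hSDQ⟩ : ∃ SDQ : LoopSeq d → (LoopSeq d → PowerSeries ℝ ⧸ I) → PowerSeries ℝ ⧸ I, ∀ A g, SDQ A g =
      ((∑ o : InvIdx A, g (A.negSplitAt o)) - ∑ o : SameIdx A, g (A.posSplitAt o))
        + π (C β) * ((∑ o : DeformIdx A, g (A.negDeformAt o)) - ∑ o : DeformIdx A, g (A.posDeformAt o)) :=
    ⟨fun A g => _, fun _ _ => rfl⟩
  obtain ⟨TWQ, hTWQ⟩ : ∃ TWQ : LoopSeq d → (LoopSeq d → PowerSeries ℝ ⧸ I) → PowerSeries ℝ ⧸ I, ∀ A g, TWQ A g =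
      (∑ o : SameIdx A, g (A.negTwistAt o)) - ∑ o : InvIdx A, g (A.posTwistAt o) := ⟨fun A g => _, fun _ _ => rfl⟩
  obtain ⟨MEQ, hMEQ⟩ : ∃ MEQ : LoopSeq d → (LoopSeq d → PowerSeries ℝ ⧸ I) → PowerSeries ℝ ⧸ I, ∀ A g, MEQ A g =
      (∑ o : MergeIdx A, g (A.negMergeAt o)) - ∑ o : MergeIdx A, g (A.posMergeAt o) := ⟨fun A g => _, fun _ _ => rfl⟩
  obtain ⟨XMQ, hXMQ⟩ : ∃ XMQ : LoopSeq d → LoopSeq d → (LoopSeq d → PowerSeries ℝ ⧸ I) → PowerSeries ℝ ⧸ I,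
      ∀ A B g, XMQ A B g =
      (∑ i : Fin A.length, ∑ j : Fin B.length,
          ∑ q : {xy : Fin (A.get i).length × Fin (B.get j).length // ((B.get j).get xy.2).1 = ((A.get i).get xy.1).1},
            (g (A.take i ++ LoopSeq.prune [Word.negMerge _ q.1.1 _ q.1.2] ++ A.drop (i + 1) ++ B.eraseIdx j)
              - g (A.take i ++ LoopSeq.prune [Word.posMerge _ q.1.1 _ q.1.2] ++ A.drop (i + 1) ++ B.eraseIdx j)))
      + ∑ j : Fin B.length, ∑ i : Fin A.length,
          ∑ q : {xy : Fin (B.get j).length × Fin (A.get i).length // ((A.get i).get xy.2).1 = ((B.get j).get xy.1).1},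
            (g (A.eraseIdx i ++ (B.take j ++ LoopSeq.prune [Word.negMerge _ q.1.1 _ q.1.2] ++ B.drop (j + 1)))
              - g (A.eraseIdx i ++ (B.take j ++ LoopSeq.prune [Word.posMerge _ q.1.1 _ q.1.2] ++ B.drop (j + 1)))) :=
    ⟨fun A B g => _, fun _ _ _ => rfl⟩
  -- conversions `π ∘ (ℝ⟦X⟧-operator) = (quotient operator) ∘ π`
  have cSD : ∀ (A : LoopSeq d) (g : LoopSeq d → PowerSeries ℝ), π (SDX A g) = SDQ A (fun u => π (g u)) := by
    intro A g; rw [hSDX, hSDQ]; simp only [map_add, map_sub, map_mul, map_sum]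
  have cTW : ∀ (A : LoopSeq d) (g : LoopSeq d → PowerSeries ℝ), π (TWX A g) = TWQ A (fun u => π (g u)) := by
    intro A g; rw [hTWX, hTWQ]; simp only [map_sub, map_sum]
  have cME : ∀ (A : LoopSeq d) (g : LoopSeq d → PowerSeries ℝ), π (MEX A g) = MEQ A (fun u => π (g u)) := by
    intro A g; rw [hMEX, hMEQ]; simp only [map_sub, map_sum]
  have cXM : ∀ (A B : LoopSeq d) (g : LoopSeq d → PowerSeries ℝ), π (XMX A B g) = XMQ A B (fun u => π (g u)) := by
    intro A B g; rw [hXMX, hXMQ]; simp only [map_add, map_sub, map_sum]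
  -- coefficient extraction through the `ℝ⟦X⟧`-operators
  have dSD : ∀ (j : ℕ) (A : LoopSeq d) (g : LoopSeq d → PowerSeries ℝ),
      coeff j (SDX A g) = SD A (fun u => coeff j (g u)) := by
    intro j A g; rw [hSDX, hSD]; simp only [map_add, map_sub, map_sum, coeff_C_mul]
  have dTW : ∀ (j : ℕ) (A : LoopSeq d) (g : LoopSeq d → PowerSeries ℝ),
      coeff j (TWX A g) = TW A (fun u => coeff j (g u)) := by
    intro j A g; rw [hTWX, hTW]; simp only [map_sub, map_sum]
  have dME : ∀ (j : ℕ) (A : LoopSeq d) (g : LoopSeq d → PowerSeries ℝ),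
      coeff j (MEX A g) = ME A (fun u => coeff j (g u)) := by
    intro j A g; rw [hMEX, hME]; simp only [map_sub, map_sum]
  have dXM : ∀ (j : ℕ) (A B : LoopSeq d) (g : LoopSeq d → PowerSeries ℝ),
      coeff j (XMX A B g) = XM A B (fun u => coeff j (g u)) := by
    intro j A B g; rw [hXMX, hXM]; simp only [map_add, map_sub, map_sum]
  have hnat : ∀ (n j : ℕ) (a : PowerSeries ℝ), coeff j ((n : PowerSeries ℝ) * a) = (n : ℝ) * coeff j a := by
    intro n j a; rw [← map_natCast (C (R := ℝ)) n, coeff_C_mul]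
  -- ### the equation in the quotient
  have hp : ∀ s : LoopSeq d, IsLoopSeq s → s ≠ [] →
      (s.len : PowerSeries ℝ ⧸ I) * π (P s) - SDQ s (fun u => π (P u)) =
        π X * ((s.len : PowerSeries ℝ ⧸ I) * π (P s) + TWQ s (fun u => π (P u))) + π X ^ 2 * MEQ s (fun u => π (P u)) := by
    intro s hs hne
    have hPmk : ∀ u : LoopSeq d, P u = PowerSeries.mk (fun k => F (k + 2) β u) := fun u => by
      ext k; rw [hP, coeff_mk]
    have h := hierarchy_mod hF0 hF1 hrec s hs hne
    simp only [← hPmk] at h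
    rw [hSDQ, hTWQ, hMEQ]
    simpa only [map_sub, map_add, map_mul, map_sum, map_pow, map_natCast] using h
  have hpPerm : ∀ s s' : LoopSeq d, IsLoopSeq s → s.Perm s' → π (P s) = π (P s') :=
    fun s s' hs h => P_mod_perm hP hperm s s' hs h
  have hG0Q : ∀ B : LoopSeq d, π (G B []) = π (P B) := fun B => by rw [hG0]
  have hGsQ : ∀ (B C : LoopSeq d) (rest : List (LoopSeq d)),
      π (G B (C :: rest)) = π (G (B ++ C) rest) - π (P C) * π (G B rest) := fun B C rest => by
    rw [hGs, map_sub, map_mul]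
  have EqQ := centered_equation (π X) (π (C β)) (fun u => π (P u)) SDQ TWQ MEQ XMQ hSDQ hTWQ hMEQ hXMQ hp hpPerm
    (G := fun B Cs => π (G B Cs)) hG0Q hGsQ Cs hCs B₀ hB₀
  -- ### back to `ℝ⟦X⟧`: the two sides agree modulo `X^{K+1}`
  have hmod : π (((B₀.len + (Cs.map LoopSeq.len).sum : ℕ) : PowerSeries ℝ) * G B₀ Cs
        - SDX B₀ (fun A => G A Cs) - ∑ j : Fin Cs.length, SDX (Cs.get j) (fun C' => G B₀ (Cs.set j C'))) =
      π (X * (((B₀.len + (Cs.map LoopSeq.len).sum : ℕ) : PowerSeries ℝ) * G B₀ Cs + TWX B₀ (fun A => G A Cs)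
              + ∑ j : Fin Cs.length, TWX (Cs.get j) (fun C' => G B₀ (Cs.set j C')))
          + X ^ 2 * (MEX B₀ (fun A => G A Cs) + (∑ j : Fin Cs.length, MEX (Cs.get j) (fun C' => G B₀ (Cs.set j C')))
              + (∑ j : Fin Cs.length, XMX B₀ (Cs.get j) (fun M => G M (Cs.eraseIdx j)))
              + ∑ j : Fin Cs.length, ∑ j' : Fin Cs.length, if (j : ℕ) < j' then
                  XMX (Cs.get j) (Cs.get j') (fun M => G B₀ ((Cs.set j M).eraseIdx j') + P M * G B₀ ((Cs.eraseIdx j').eraseIdx j))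
                else 0)) := by
    simpa only [map_sub, map_add, map_mul, map_sum, map_pow, map_natCast, apply_ite π, map_zero, cSD, cTW, cME, cXM]
      using EqQ
  have hc := coeff_eq_of_mk_eq hmod k hk
  -- ### coefficientwise
  obtain ⟨hX0, hX1, hX2⟩ := coeff_X_sq_mul (MEX B₀ (fun A => G A Cs)
      + (∑ j : Fin Cs.length, MEX (Cs.get j) (fun C' => G B₀ (Cs.set j C')))
      + (∑ j : Fin Cs.length, XMX B₀ (Cs.get j) (fun M => G M (Cs.eraseIdx j)))
      + ∑ j : Fin Cs.length, ∑ j' : Fin Cs.length, if (j : ℕ) < j' then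
          XMX (Cs.get j) (Cs.get j') (fun M => G B₀ ((Cs.set j M).eraseIdx j') + P M * G B₀ ((Cs.eraseIdx j').eraseIdx j))
        else 0) k
  rcases k with _ | _ | k
  · rw [map_add, coeff_zero_X_mul, hX0] at hc
    simp only [map_sub, map_sum, hnat, dSD, add_zero] at hc
    simp only [↓reduceIte, if_pos (by norm_num : (0 : ℕ) < 2), add_zero]
    exact hc
  · rw [map_add, coeff_succ_X_mul, hX1] at hc
    simp only [map_sub, map_add, map_sum, hnat, dSD, dTW, add_zero] at hc
    simp only [Nat.add_one_ne_zero, if_false, if_pos (by norm_num : (0 + 1 : ℕ) < 2), add_zero, Nat.add_sub_cancel]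
    exact hc
  · obtain ⟨-, -, hXk⟩ := coeff_X_sq_mul (MEX B₀ (fun A => G A Cs)
        + (∑ j : Fin Cs.length, MEX (Cs.get j) (fun C' => G B₀ (Cs.set j C')))
        + (∑ j : Fin Cs.length, XMX B₀ (Cs.get j) (fun M => G M (Cs.eraseIdx j)))
        + ∑ j : Fin Cs.length, ∑ j' : Fin Cs.length, if (j : ℕ) < j' then
            XMX (Cs.get j) (Cs.get j') (fun M => G B₀ ((Cs.set j M).eraseIdx j') + P M * G B₀ ((Cs.eraseIdx j').eraseIdx j))
          else 0) k
    rw [map_add, coeff_succ_X_mul, hXk] at hc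
    simp only [map_sub, map_add, map_sum, hnat, dSD, dTW, dME, dXM, apply_ite (coeff k), map_zero, PowerSeries.coeff_mul,
      hP] at hc
    simp only [Nat.add_one_ne_zero, if_false, show ¬ (k + 1 + 1 < 2) by omega, Nat.add_sub_cancel,
      show k + 1 + 1 - 2 = k by omega]
    exact hc

end StringDuality

end Summit.QuantumFields.GaugeBoot

end
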